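import Mathlib
import Literature.Analysis.FluidPDE.TaoCascadeModeDuhamel
import Summits.NavierStokesRegularity.NavierStokesRegularity.Theses.PerpetualPump

/-!
# Sketch — crux-ideate, PumpTransfer (stmt-NavierStokesRegularity-1837), ideator 3, round 1

First lemmas of the three idea cards (signatures over existing declarations; nothing here is
proved except where a proof is given).  `PumpTransfer ≡ CircuitPump → AveragedTypeIBlowup`.

* Card A `volterra-memory-exactness`   : `VolterraModeIdentity`, `MildOfVolterra`.
* Card B `energy-budget-threshold`     : `NoEternalCriticalActivity`.
* Card C `window-crossing-pump`        : `window_tracking` (PROVED), `SkewWindowTracking`.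
-/

noncomputable section

open MeasureTheory Set Filter
open scoped SchwartzMap

namespace Summit.NavierStokesRegularity.NavierStokesRegularity.Cruxes.PumpTransfer.Ideator3

open Literature.Analysis.FluidPDE Literature.Analysis.FluidPDE.Tao2016

/-- the crux, by name (sanity: the route decl is in scope). -/
example : Prop := Summit.NavierStokesRegularity.NavierStokesRegularity.Theses.PerpetualPump.PumpTransfer

/-! ## Card A — the cascade PDE is EXACTLY an autonomous Volterra circuit -/

/-- The heat autocorrelation `g_ψ(τ) = ⟨e^{τΔ}ψ, ψ⟩ = ∫ e^{-4π²τ|ξ|²} |ψ̂(ξ)|² dξ` of a profile `ψ`: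
the MEMORY KERNEL of the exact mode equation. It is the Laplace transform of the push-forward of
`|ψ̂|² dξ` under `ξ ↦ 4π²|ξ|²` (a probability measure when `‖ψ‖₂ = 1`), hence completely monotone,
`g(0) = 1`; for a profile whose Fourier support lies in a shell `{r - η ≤ |ξ| ≤ r + η}` one has
`e^{-4π²(r+η)²τ} ≤ g(τ) ≤ e^{-4π²(r-η)²τ}`: an `O(η)`-perturbation of a pure exponential, with `η`
(ball radius in `CascadeWaveletData`) independent of Tao's `ε₀`. -/
def heatAutocorr (ψ : 𝓢(EuclideanSpace ℝ (Fin 3), EuclideanSpace ℝ (Fin 3))) (τ : ℝ) : ℝ :=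
  (pairing (heat τ (schwartzL2 ψ)) (schwartzL2 ψ)).re

/-- **Card A, first lemma (forward half): the exact Volterra identity.** For a mild `H¹⁰_df` solution
of the cascade equation `∂ₜu = Δu + C(u,u)` (Tao (3.3) with the operator (4.1) of wavelet data `𝒟`)
from the single-wavelet datum `ψ_{i₀,n₀}`, the coefficients `X_{i,n}(t) = ⟨u(t), ψ_{i,n}⟩` solve
`X_{i,n}(t) = 1_{(i,n)=(i₀,n₀)} g_{ψᵢ}((1+ε₀)^{2n}t) + ∫₀ᵗ quadTerm(X)_{i,n}(s) g_{ψᵢ}((1+ε₀)^{2n}(t-s)) ds`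
EXACTLY — no `O((1+ε₀)^{2n}E^{1/2})` error, no energy defect: pair Tao's projected Duhamel formula
(4.14) (`IsMildSolutionFor.pairing_eq_inner_modeDuhamel`, in tree) with `ψ_{i,n}` and use
`⟨e^{τΔ}ψ_{i,n}, ψ_{i,n}⟩ = g_{ψᵢ}((1+ε₀)^{2n}τ)` (dilation covariance of the heat flow). -/
def VolterraModeIdentity : Prop :=
  ∀ (ε₀ : ℝ), 0 < ε₀ → ε₀ < 1 → ∀ (m : ℕ) (𝒟 : CascadeWaveletData ε₀ m)
    (α : Fin m → Fin m → Fin m → ℤ × ℤ × ℤ → ℝ) (i₀ : Fin m) (n₀ : ℤ) (T : ℝ) (u : ℝ → L2C),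
    IsMildSolutionFor (cascadeOperatorForm ε₀ 𝒟.ψ α) (cascadeWavelet ε₀ (𝒟.ψ i₀) n₀)
      (Set.Ico 0 T) u →
    ∀ (i : Fin m) (n : ℤ), ∀ t ∈ Set.Ico 0 T,
      modeCoeff 𝒟 u i n t =
        (if i = i₀ ∧ n = n₀ then heatAutocorr (𝒟.ψ i) ((1 + ε₀) ^ (2 * n) * t) else 0) +
        ∫ s in (0 : ℝ)..t, TaoCascade.quadTerm ε₀ α (modeCoeff 𝒟 u) i n s *
          heatAutocorr (𝒟.ψ i) ((1 + ε₀) ^ (2 * n) * (t - s))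

/-- **Card A, synthesis half: Volterra solutions ARE mild solutions.** Every solution of the Volterra
circuit on `[0,T)` with no modes below `n₀` and super-polynomial decay in the scale index is the
coefficient family of an honest mild `H¹⁰_df` solution on `[0,T)` (built by the band Duhamel formula
`u(t) = e^{tΔ}ψ_{i₀,n₀} + Σ_{i,n} ∫₀ᵗ quadTerm(X)_{i,n}(s) e^{(t-s)Δ}ψ_{i,n} ds`, tree `duhamelV`): no
PDE local theory is needed to PRODUCE the forward solution that `AveragedTypeIBlowup` asks for. -/
def MildOfVolterra : Prop :=
  ∀ (ε₀ : ℝ), 0 < ε₀ → ε₀ < 1 → ∀ (m : ℕ) (𝒟 : CascadeWaveletData ε₀ m)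
    (α : Fin m → Fin m → Fin m → ℤ × ℤ × ℤ → ℝ) (i₀ : Fin m) (n₀ : ℤ) (T : ℝ), 0 < T →
    ∀ X : Fin m → ℤ → ℝ → ℝ,
    (∀ i n, ContinuousOn (X i n) (Set.Ico 0 T)) →
    (∀ i n t, n < n₀ → X i n t = 0) →
    (∀ T' ∈ Set.Ioo 0 T, ∃ C : ℝ, ∀ i n, ∀ t ∈ Set.Icc 0 T',
        (1 + ε₀) ^ (12 * n) * |X i n t| ≤ C) →
    (∀ (i : Fin m) (n : ℤ), ∀ t ∈ Set.Ico 0 T,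
      X i n t =
        (if i = i₀ ∧ n = n₀ then heatAutocorr (𝒟.ψ i) ((1 + ε₀) ^ (2 * n) * t) else 0) +
        ∫ s in (0 : ℝ)..t, TaoCascade.quadTerm ε₀ α X i n s *
          heatAutocorr (𝒟.ψ i) ((1 + ε₀) ^ (2 * n) * (t - s))) →
    ∃ u : ℝ → L2C,
      IsMildSolutionFor (cascadeOperatorForm ε₀ 𝒟.ψ α) (cascadeWavelet ε₀ (𝒟.ψ i₀) n₀)
        (Set.Ico 0 T) u ∧
      ∀ (i : Fin m) (n : ℤ), ∀ t ∈ Set.Ico 0 T, modeCoeff 𝒟 u i n t = X i n t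

/-! ## Card B — energy budget ⇒ decay/blow-up dichotomy ⇒ threshold shooting -/

/-- **Card B, first lemma: NO ETERNAL CRITICAL ACTIVITY.** For Tao's autonomous circuit class (4.3)
at `α = 2/5` (literally the `F` of `CircuitPump` / `CircuitTrace`: dissipation `lam^{4n/5}`, strength
`lam^n`, offsets `S`, symmetric + cyclic-cancelling structure constants), a forward solution on `[0,T)`
with no modes below `n = 0`, finitely supported datum and a-priori regularity whose `ℓ^∞`-in-scale
CRITICAL amplitude `sup_{i,n} lam^{n/5}|X_{i,n}(t)|` stays `≥ δ` throughout `[0,T)` has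
`T ≤ Σ X(0)² / (2δ²)`: the energy identity `d/dt ½ΣX² = -Σ lam^{4n/5}X²` (cyclic cancellation) and
`lam^{4n/5}X_{i,n}² ≥ δ² lam^{2n/5} ≥ δ²` at an active scale `n ≥ 0`. Corollary: every GLOBAL solution
dips below every critical threshold; with small-critical-data decay this makes the forward dynamics
an exact DICHOTOMY decay / finite-time blow-up, so the threshold datum on a one-parameter family blows
up — with no orbit followed and no hyperbolicity used. -/
def NoEternalCriticalActivity : Prop :=
  ∀ lam : ℝ, 1 < lam → ∀ (m : ℕ) (coeff : Fin m → Fin m → Fin m → Option (Fin 3) → ℝ),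
    (∀ (i₁ i₂ i₃ : Fin m) (μ : Option (Fin 3)),
        coeff i₁ i₂ i₃ μ = coeff i₂ i₁ i₃ (Option.map (Equiv.swap (0 : Fin 3) 1) μ)) →
    (∀ (v : Fin 3 → Fin m) (μ : Option (Fin 3)),
        ∑ σ : Equiv.Perm (Fin 3), coeff (v (σ 0)) (v (σ 1)) (v (σ 2)) (Option.map σ.symm μ) = 0) →
    ∀ T : ℝ, 0 < T → ∀ X : Fin m → ℤ → ℝ → ℝ,
    let F : Fin m → ℤ → ℝ → ℝ := fun (i : Fin m) (n : ℤ) (t : ℝ) =>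
      -(lam ^ ((4 / 5 : ℝ) * n)) * X i n t +
        ∑ i₁ : Fin m, ∑ i₂ : Fin m, ∑ μ : Option (Fin 3),
          coeff i₁ i₂ i μ * lam ^ ((n : ℝ) - (if μ = some 2 then 1 else 0)) *
            X i₁ (n + ((if μ = some 0 then 1 else 0) - (if μ = some 2 then 1 else 0))) t *
            X i₂ (n + ((if μ = some 1 then 1 else 0) - (if μ = some 2 then 1 else 0))) t;
    (∀ (i : Fin m) (n : ℤ), ContinuousOn (X i n) (Set.Ico 0 T)) →
    (∀ (i : Fin m) (n : ℤ), ∀ t ∈ Set.Ioo 0 T, HasDerivAt (X i n) (F i n t) t) →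
    (∀ (i : Fin m) (n : ℤ) (t : ℝ), n < 0 → X i n t = 0) →
    (∀ T' ∈ Set.Ioo 0 T, ∃ C : ℝ, ∀ (i : Fin m) (n : ℤ), ∀ t ∈ Set.Icc 0 T',
        lam ^ ((4 : ℝ) * n) * |X i n t| ≤ C) →
    ∀ s : Finset (Fin m × ℤ), (∀ (i : Fin m) (n : ℤ), (i, n) ∉ s → X i n 0 = 0) →
    ∀ δ : ℝ, 0 < δ →
    (∀ t ∈ Set.Ico 0 T, ∃ (i : Fin m) (n : ℤ), δ ≤ lam ^ ((1 / 5 : ℝ) * n) * |X i n t|) →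
    T ≤ (∑ p ∈ s, X p.1 p.2 0 ^ 2) / (2 * δ ^ 2)

/-! ## Card C — window crossing: topological expansion replaces hyperbolicity -/

/-- Iterates `x_j` of a non-autonomous sequence of maps: `iterSeq Φ 0 = id`,
`iterSeq Φ (j+1) = Φ j ∘ iterSeq Φ j`. -/
def iterSeq (Φ : ℕ → ℝ → ℝ) : ℕ → ℝ → ℝ
  | 0 => id
  | j + 1 => Φ j ∘ iterSeq Φ j

@[simp] theorem iterSeq_zero (Φ : ℕ → ℝ → ℝ) (x : ℝ) : iterSeq Φ 0 x = x := rfl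

theorem iterSeq_succ (Φ : ℕ → ℝ → ℝ) (j : ℕ) (x : ℝ) :
    iterSeq Φ (j + 1) x = Φ j (iterSeq Φ j x) := rfl

theorem continuous_iterSeq (Φ : ℕ → ℝ → ℝ) (hc : ∀ j, Continuous (Φ j)) :
    ∀ j, Continuous (iterSeq Φ j)
  | 0 => continuous_id
  | j + 1 => (hc j).comp (continuous_iterSeq Φ hc j)

/-- **Card C, first lemma (1-D, non-autonomous): REPELLER TRACKING BY WINDOW CROSSING** — PROVED. If continuous
maps `Φ_j : ℝ → ℝ` all map the left end of the window `[a-r, a+r]` to its left and the right end to its right, some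
orbit `x_{j+1} = Φ_j(x_j)` stays in the window for ever. Proof: by the intermediate value theorem every point of the
window has a Φ_j-preimage in the window, so backward induction gives, for every `N`, an initial point whose first `N`
iterates stay in the window; these initial sets are closed, nested and non-empty in a compact interval, hence have a
common point (Cantor). No contraction, no smallness, no autonomy: only the SIGN of `Φ_j - id` at two points — an open
condition with margin, stable under every `C⁰`-small perturbation (the `O(ε₀)`/`O(η²)` errors of the PDE
realisation). In the line `Φ_j` is the `j`-th cell-renormalisation map of the (Volterra-exact) PDE solution in the
critical-amplitude coordinate `h = log(A/A*)`. -/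
theorem window_tracking (a r : ℝ) (Φ : ℕ → ℝ → ℝ) (hc : ∀ j, Continuous (Φ j))
    (hlo : ∀ j, Φ j (a - r) ≤ a - r) (hhi : ∀ j, a + r ≤ Φ j (a + r)) (hr : 0 ≤ r) :
    ∃ x : ℕ → ℝ, (∀ j, x (j + 1) = Φ j (x j)) ∧ ∀ j, x j ∈ Set.Icc (a - r) (a + r) := by
  classical
  have hab : a - r ≤ a + r := by linarith
  -- backward chains: every window point is the `N`-th iterate of a point whose first `N` iterates stay inside
  have chain : ∀ N : ℕ, ∀ y ∈ Set.Icc (a - r) (a + r),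
      ∃ x₀ : ℝ, (∀ j ≤ N, iterSeq Φ j x₀ ∈ Set.Icc (a - r) (a + r)) ∧ iterSeq Φ N x₀ = y := by
    intro N
    induction N with
    | zero =>
      intro y hy
      refine ⟨y, fun j hj => ?_, rfl⟩
      rw [Nat.le_zero.mp hj]
      exact hy
    | succ N ih =>
      intro y hy
      have hsurj : Set.Icc (Φ N (a - r)) (Φ N (a + r)) ⊆ Φ N '' Set.Icc (a - r) (a + r) :=
        intermediate_value_Icc hab (hc N).continuousOn
      obtain ⟨z, hz, hzy⟩ := hsurj ⟨(hlo N).trans hy.1, hy.2.trans (hhi N)⟩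
      obtain ⟨x₀, hx₀, hNz⟩ := ih z hz
      refine ⟨x₀, fun j hj => ?_, ?_⟩
      · rcases Nat.lt_or_ge j (N + 1) with h | h
        · exact hx₀ j (Nat.lt_succ_iff.mp h)
        · have hj' : j = N + 1 := le_antisymm hj h
          rw [hj', iterSeq_succ, hNz, hzy]
          exact hy
      · rw [iterSeq_succ, hNz, hzy]
  -- nested closed non-empty subsets of the compact window
  let S : ℕ → Set ℝ := fun N => {x | ∀ j ≤ N, iterSeq Φ j x ∈ Set.Icc (a - r) (a + r)}
  have hS_closed : ∀ N, IsClosed (S N) := by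
    intro N
    have hS : S N = ⋂ j, ⋂ (_ : j ≤ N), iterSeq Φ j ⁻¹' Set.Icc (a - r) (a + r) := by
      ext x
      simp [S]
    rw [hS]
    exact isClosed_iInter fun j => isClosed_iInter fun _ =>
      isClosed_Icc.preimage (continuous_iterSeq Φ hc j)
  have hS_anti : ∀ N, S (N + 1) ⊆ S N := fun N x hx j hj => hx j (hj.trans (Nat.le_succ N))
  have hS_ne : ∀ N, (S N).Nonempty := by
    intro N
    obtain ⟨x₀, hx₀, -⟩ := chain N (a - r) ⟨le_rfl, hab⟩
    exact ⟨x₀, hx₀⟩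
  have hS0 : IsCompact (S 0) := by
    have h0 : S 0 = Set.Icc (a - r) (a + r) := by
      ext x
      simp [S]
    rw [h0]
    exact isCompact_Icc
  obtain ⟨x₀, hx₀⟩ :=
    IsCompact.nonempty_iInter_of_sequence_nonempty_isCompact_isClosed S hS_anti hS_ne hS0 hS_closed
  refine ⟨fun j => iterSeq Φ j x₀, fun j => rfl, fun j => ?_⟩
  exact (Set.mem_iInter.mp hx₀ j) j le_rfl

/-- **Card C, skew-product form (the one the line uses): crossing uniform over a compact trapped
fibre.** `Y` = the slaved variables (shape within the active cell, frozen trail, memory) in their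
trapping region; `Φ` = one renormalised DSS period. If the amplitude window is crossed for EVERY fibre
state, then from every initial fibre state `y₀` (e.g. the bare truncated datum: no trail, no memory)
some initial amplitude `x₀` keeps the amplitude in the window for all periods — the threshold datum
`A* ψ_{1,n₀}` whose solution is two-sided Type I, hence blows up at the Type-I rate. -/
def SkewWindowTracking : Prop :=
  ∀ (Y : Type) [TopologicalSpace Y] [CompactSpace Y] (a r : ℝ), 0 ≤ r →
    ∀ Φ : ℝ × Y → ℝ × Y, Continuous Φ →
      (∀ y : Y, (Φ (a - r, y)).1 ≤ a - r) → (∀ y : Y, a + r ≤ (Φ (a + r, y)).1) →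
      ∀ y₀ : Y, ∃ x₀ ∈ Set.Icc (a - r) (a + r),
        ∀ j : ℕ, (Φ^[j] (x₀, y₀)).1 ∈ Set.Icc (a - r) (a + r)

end Summit.NavierStokesRegularity.NavierStokesRegularity.Cruxes.PumpTransfer.Ideator3
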